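import Literature.NumberTheory.EllipticCurves.CuspFormTwistAtkinLehnerProofs
import HarnessLib

/-!
# The Fricke involution of a quadratic twist at coprime level (Atkin–Lehner 1970, §6)

Let `f ∈ S_k(Γ₀(N))`, `m ≥ 1` coprime to `N`, and `χ` a quadratic Dirichlet character mod `m`. The
twist `f_χ = g(χ)⁻¹ ∑_{u mod m} χ(u) f(τ + u/m) ∈ S_k(Γ₀(N m²))` (`charTwist`, file `CuspFormTwist`;
Shimura 1971, Prop. 3.64) satisfies

`w_{Nm²} (f_χ) = χ(−1) χ(N) · (w_N f)_χ`

(`frickeInvolution_charTwist`), for Knapp's `det^{k/2}`-normalised Fricke involutions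
`w_M = M^{1−k/2} [Γ₀(M) (0 −1; M 0) Γ₀(M)]` of the tree (`frickeInvolution`). In particular, if
`w_N f = ε f` then `w_{Nm²} f_χ = χ(−N) ε f_χ` (`frickeInvolution_charTwist_of_eq_smul`): the sign of
the functional equation of `L(f ⊗ χ, s)` is `χ(−N)` times that of `L(f, s)` (Atkin–Lehner 1970, §6,
Thm. 6; Shimura 1971, Thm. 3.66; Iwaniec 1997, Thm. 7.5; for a newform `f` attached to an elliptic
curve `E/ℚ` and `χ = χ_D` this is the classical `w(E^{(D)}) = χ_D(−N) w(E)` for `(D, N) = 1`).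

## Proof

For a unit `u mod m` put `v = −(uN)⁻¹ mod m`, `U = u.val`, `V = v.val`, `md = 1 + UNV`. A direct
computation (`exists_twistT_mul_frickeGL_eq`) gives the matrix identity

`[1, U/m; 0, 1] · (0 −1; Nm² 0) = (m · 1) · (0 −1; N 0) · γ_u · [1, V/m; 0, 1]`,
`γ_u = (m, −V; −UN, d) ∈ Γ₀(N)`,

so `(f ∣ [1,U/m;0,1]) ∣ w(Nm²) = m^{k−2} ((f ∣ w(N)) ∣ γ_u) ∣ [1,V/m;0,1] = m^{k−2} (f ∣ w(N)) ∣ [1,V/m;0,1]`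
(`w(N)` normalises `Γ₀(N)`); re-indexing the character sum over the units by the involution
`u ↦ −(uN)⁻¹` and using `χ(−(vN)⁻¹) = χ(−1) χ(N) χ(v)` (`χ` quadratic) yields
`(∑_u χ(u) f ∣ T_u) ∣ w(Nm²) = m^{k−2} χ(−1) χ(N) ∑_v χ(v) (f ∣ w(N)) ∣ T_v`
(`coe_twistRaw_slash_frickeGL`), and the normalising constants satisfy
`(Nm²)^{1−k/2} m^{k−2} = N^{1−k/2}`.

Everything here is proved; no definitions of substance and no named facts are introduced.

## References

* A. O. L. Atkin, J. Lehner, *Hecke operators on `Γ₀(m)`*, Math. Ann. 185 (1970), 134–160, §6.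
* G. Shimura, *Introduction to the arithmetic theory of automorphic functions*, 1971, Prop. 3.64,
  Thm. 3.66.
* H. Iwaniec, *Topics in classical automorphic forms*, GSM 17, AMS 1997, Thm. 7.5.
* A. O. L. Atkin, W.-C. W. Li, *Twists of newforms and pseudo-eigenvalues of `W`-operators*,
  Invent. Math. 48 (1978), 221–243, §3.
-/

noncomputable section

open scoped MatrixGroups ModularForm

open CongruenceSubgroup Matrix.SpecialLinearGroup Matrix.GeneralLinearGroup UpperHalfPlane Complex

namespace Literature.NumberTheory.EllipticCurves.ModularForms

/-! ### Sums of character-weighted terms live on the units -/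

section Units

variable {m : ℕ} [NeZero m]

/-- A sum over `ℤ/m` of terms vanishing off the units is a sum over `(ℤ/m)ˣ`. [folklore] -/
theorem sum_univ_eq_sum_units {M : Type*} [AddCommMonoid M] (G : ZMod m → M)
    (hG : ∀ u, ¬ IsUnit u → G u = 0) : ∑ u : ZMod m, G u = ∑ w : (ZMod m)ˣ, G w := by
  have h1 : ∑ w : (ZMod m)ˣ, G w =
      ∑ x ∈ (Finset.univ : Finset (ZMod m)ˣ).map ⟨((↑) : (ZMod m)ˣ → ZMod m), Units.val_injective⟩,
        G x :=
    (Finset.sum_map Finset.univ ⟨((↑) : (ZMod m)ˣ → ZMod m), Units.val_injective⟩ G).symm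
  rw [h1]
  refine (Finset.sum_subset (Finset.subset_univ _) fun u _ hu ↦ hG u fun hunit ↦ hu ?_).symm
  exact Finset.mem_map.mpr ⟨hunit.unit, Finset.mem_univ _, hunit.unit_spec⟩

omit [NeZero m] in
/-- A quadratic character takes the same value at a unit and at its inverse. [folklore] -/
theorem apply_units_inv_of_isQuadratic {R' : Type*} [CommRing R'] {χ : MulChar (ZMod m) R'}
    (hχ : χ.IsQuadratic) (w : (ZMod m)ˣ) : χ ((w⁻¹ : (ZMod m)ˣ) : ZMod m) = χ (w : ZMod m) := by
  have h := apply_sq_eq_one_of_isQuadratic hχ w.isUnit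
  have h2 : χ (w : ZMod m) * χ ((w⁻¹ : (ZMod m)ˣ) : ZMod m) = 1 := by
    rw [← map_mul, ← Units.val_mul, mul_inv_cancel, Units.val_one, map_one]
  linear_combination -(χ ((w⁻¹ : (ZMod m)ˣ) : ZMod m)) * h + (χ (w : ZMod m)) * h2

end Units

/-! ### The re-indexing involution `u ↦ −(uN)⁻¹` of `(ℤ/m)ˣ` -/

section Perm

variable {N m : ℕ}

/-! The re-indexing map is `u ↦ −(uN)⁻¹ = u⁻¹ (−N̄)⁻¹` on `(ℤ/m)ˣ`, with `N̄ = ZMod.unitOfCoprime N hNm`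
the unit of `ℤ/m` defined by `N`; it is written out in full below (no auxiliary definition). -/

/-- `u ↦ −(uN)⁻¹ = u⁻¹ (−N̄)⁻¹` is an involution of `(ℤ/m)ˣ`. [folklore] -/
theorem frickeTwistPerm_involutive (hNm : N.Coprime m) :
    Function.Involutive (fun u : (ZMod m)ˣ ↦ u⁻¹ * (-ZMod.unitOfCoprime N hNm)⁻¹) := by
  intro u
  simp only [mul_inv_rev, inv_inv]
  rw [mul_comm (-ZMod.unitOfCoprime N hNm) u, mul_inv_cancel_right]

/-- `u · N · (−(uN)⁻¹) = −1` in `ℤ/m`. [folklore] -/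
theorem val_mul_natCast_mul_val_frickeTwistPerm (hNm : N.Coprime m) (u : (ZMod m)ˣ) :
    (u : ZMod m) * (N : ZMod m) * ((u⁻¹ * (-ZMod.unitOfCoprime N hNm)⁻¹ : (ZMod m)ˣ) : ZMod m) =
      -1 := by
  rw [← ZMod.coe_unitOfCoprime N hNm, ← Units.val_mul, ← Units.val_mul,
    mul_mul_mul_comm, mul_inv_cancel, one_mul, inv_neg, mul_neg, mul_inv_cancel, Units.val_neg,
    Units.val_one]

/-- `χ(−(uN)⁻¹) = χ(−1) χ(N) χ(u)` for a quadratic character `χ` mod `m`. [folklore] -/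
theorem apply_frickeTwistPerm {χ : DirichletCharacter ℂ m} (hχ : χ.IsQuadratic)
    (hNm : N.Coprime m) (u : (ZMod m)ˣ) :
    χ ((u⁻¹ * (-ZMod.unitOfCoprime N hNm)⁻¹ : (ZMod m)ˣ) : ZMod m) =
      χ (-1) * χ N * χ (u : ZMod m) := by
  rw [Units.val_mul, map_mul, apply_units_inv_of_isQuadratic hχ,
    apply_units_inv_of_isQuadratic hχ, Units.val_neg, ZMod.coe_unitOfCoprime, neg_eq_neg_one_mul,
    map_mul]
  ring

end Perm

/-! ### The matrix identity behind `w_{Nm²}` on twists -/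

section Matrices

variable {N : ℕ} [NeZero N] {m : ℕ} [NeZero m]

/-- **The matrix identity behind the Fricke involution of a twist** (Atkin–Lehner 1970, §6):
for a unit `u mod m`, `(m, N) = 1`, `v = −(uN)⁻¹ mod m`, `U = u.val`, `V = v.val`, `md = 1 + UNV`:
`[1, U/m; 0, 1] (0 −1; Nm² 0) = (m · 1) (0 −1; N 0) γ_u [1, V/m; 0, 1]` with
`γ_u = (m, −V; −UN, d) ∈ Γ₀(N)`. [cite: AtkinLehner1970, §6] -/
theorem exists_twistT_mul_frickeGL_eq (hNm : N.Coprime m) (u : (ZMod m)ˣ) :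
    ∃ γ' ∈ Gamma0 N,
      twistT (u : ZMod m) * glCast (frickeGL (N * m ^ 2) : GL (Fin 2) ℚ) =
        tpD m * tpG m * glCast (frickeGL N : GL (Fin 2) ℚ) * (mapGL ℝ γ' : GL (Fin 2) ℝ) *
          twistT ((u⁻¹ * (-ZMod.unitOfCoprime N hNm)⁻¹ : (ZMod m)ˣ) : ZMod m) := by
  set v : ZMod m := ((u⁻¹ * (-ZMod.unitOfCoprime N hNm)⁻¹ : (ZMod m)ˣ) : ZMod m) with hv
  set U : ℤ := ((u : ZMod m).val : ℤ) with hU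
  set V : ℤ := (v.val : ℤ) with hV
  have hm0 : (m : ℝ) ≠ 0 := by exact_mod_cast NeZero.ne m
  -- `m ∣ 1 + U N V`
  have hdvd : (m : ℤ) ∣ 1 + U * N * V := by
    rw [← ZMod.intCast_zmod_eq_zero_iff_dvd]
    have hUc : ((U : ℤ) : ZMod m) = (u : ZMod m) := by simp [hU]
    have hVc : ((V : ℤ) : ZMod m) = v := by simp [hV]
    push_cast
    rw [hUc, hVc, hv, val_mul_natCast_mul_val_frickeTwistPerm hNm u, add_neg_cancel]
  obtain ⟨d, hd⟩ := hdvd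
  let A : Matrix (Fin 2) (Fin 2) ℤ := !![(m : ℤ), -V; -(U * N), d]
  have hA : A.det = 1 := by
    rw [Matrix.det_fin_two_of]
    linear_combination -hd
  refine ⟨⟨A, hA⟩, ?_, ?_⟩
  · rw [Gamma0_mem]
    simp only [A, Matrix.of_apply, Matrix.cons_val', Matrix.cons_val_zero, Matrix.cons_val_one,
      Matrix.cons_val_fin_one]
    rw [ZMod.intCast_zmod_eq_zero_iff_dvd]
    exact ⟨-U, by ring⟩
  · refine Units.ext ?_
    have hUr : (((u : ZMod m).val : ℕ) : ℝ) = (U : ℝ) := by rw [hU]; push_cast; rfl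
    have hVr : ((v.val : ℕ) : ℝ) = (V : ℝ) := by rw [hV]; push_cast; rfl
    have hdr : (1 : ℝ) + U * N * V = m * d := by exact_mod_cast hd
    have hL : (((N * m ^ 2 : ℕ)) : ℝ) = (N : ℝ) * (m : ℝ) ^ 2 := by push_cast; ring
    have hAmap : (((⟨A, hA⟩ : SL(2, ℤ)) : Matrix (Fin 2) (Fin 2) ℤ).map fun z : ℤ ↦ (z : ℝ)) =
        !![(m : ℝ), -(V : ℝ); -((U : ℝ) * N), (d : ℝ)] := by
      ext i j
      fin_cases i <;> fin_cases j <;> simp [A]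
    simp only [Matrix.GeneralLinearGroup.coe_mul, val_twistT, val_glCast_frickeGL, val_tpD, val_tpG,
      val_mapGL', hAmap, hUr, hVr, hL]
    ext i j
    fin_cases i <;> fin_cases j <;> simp [Matrix.mul_apply, Fin.sum_univ_two] <;> field_simp <;>
      (first | ring1 | linear_combination hdr | linear_combination -hdr)

end Matrices

/-! ### `f_χ ∣ w(Nm²) = m^{k−2} χ(−1) χ(N) (f ∣ w(N))_χ` -/

section Slash

variable {N : ℕ} [NeZero N] {k : ℤ} {m : ℕ} [NeZero m]

/-- `(f ∣ w_N) ∣ γ = f ∣ w_N` for `γ ∈ Γ₀(N)`: `w_N` normalises `Γ₀(N)`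
(`frickeGL_mul_mul_inv_mem`). [folklore] -/
theorem slash_frickeGL_slash_mapGL (f : CuspForm (Gamma0 N) k) {γ : SL(2, ℤ)} (hγ : γ ∈ Gamma0 N) :
    ((⇑f : ℍ → ℂ) ∣[k] glCast (frickeGL N : GL (Fin 2) ℚ)) ∣[k] (mapGL ℝ γ : GL (Fin 2) ℝ) =
      (⇑f : ℍ → ℂ) ∣[k] glCast (frickeGL N : GL (Fin 2) ℚ) := by
  have hx : (mapGL ℝ γ : GL (Fin 2) ℝ) ∈ (Gamma0 N : Subgroup (GL (Fin 2) ℝ)) := ⟨γ, hγ, rfl⟩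
  have hmem := frickeGL_mul_mul_inv_mem N hx
  rw [← SlashAction.slash_mul,
    show glCast (frickeGL N : GL (Fin 2) ℚ) * (mapGL ℝ γ : GL (Fin 2) ℝ) =
      glCast (frickeGL N : GL (Fin 2) ℚ) * (mapGL ℝ γ : GL (Fin 2) ℝ) *
        (glCast (frickeGL N : GL (Fin 2) ℚ))⁻¹ * glCast (frickeGL N : GL (Fin 2) ℚ) by group,
    SlashAction.slash_mul, SlashInvariantFormClass.slash_action_eq f _ hmem]

/-- **`(∑_u χ(u) f(· + u/m)) ∣ w(Nm²) = m^{k−2} χ(−1) χ(N) ∑_v χ(v) (f ∣ w(N))(· + v/m)`** for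
`f ∈ S_k(Γ₀(N))`, `(m, N) = 1` and `χ` quadratic mod `m` (Atkin–Lehner 1970, §6; the sums may be
taken over all of `ℤ/m`, the terms at non-units vanishing). [cite: AtkinLehner1970, §6] -/
theorem coe_twistRaw_slash_frickeGL (hNm : N.Coprime m) (f : CuspForm (Gamma0 N) k)
    {χ : DirichletCharacter ℂ m} (hχ : χ.IsQuadratic) :
    (⇑(twistRaw (N * m ^ 2) (dvd_mul_right N (m ^ 2)) (dvd_mul_left (m ^ 2) N) f χ) : ℍ → ℂ) ∣[k]
        glCast (frickeGL (N * m ^ 2) : GL (Fin 2) ℚ) =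
      ((m : ℂ) ^ (k - 2) * χ (-1) * χ N) •
        ∑ w : ZMod m, χ⁻¹ w •
          (((⇑f : ℍ → ℂ) ∣[k] glCast (frickeGL N : GL (Fin 2) ℚ)) ∣[k] twistT w) := by
  set WN := glCast (frickeGL N : GL (Fin 2) ℚ) with hWN
  set WL := glCast (frickeGL (N * m ^ 2) : GL (Fin 2) ℚ) with hWL
  set e : (ZMod m)ˣ → (ZMod m)ˣ := fun u ↦ u⁻¹ * (-ZMod.unitOfCoprime N hNm)⁻¹ with hedef
  have he : Function.Involutive e := frickeTwistPerm_involutive hNm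
  -- the identity for a unit `u`
  have key : ∀ u : (ZMod m)ˣ,
      (χ (u : ZMod m) • ((⇑f : ℍ → ℂ) ∣[k] twistT (u : ZMod m))) ∣[k] WL =
        (χ (u : ZMod m) * (m : ℂ) ^ (k - 2)) •
          (((⇑f : ℍ → ℂ) ∣[k] WN) ∣[k] twistT (e u : ZMod m)) := by
    intro u
    obtain ⟨γ', hγ', hmat⟩ := exists_twistT_mul_frickeGL_eq hNm u
    rw [ModularForm.smul_slash, hWL, σ_glCast, ← SlashAction.slash_mul, hmat, SlashAction.slash_mul,
      SlashAction.slash_mul, SlashAction.slash_mul, slash_tpD_mul_tpG, ModularForm.smul_slash, σ_glCast,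
      ModularForm.smul_slash, σ_mapGL, ModularForm.smul_slash, σ_twistT, ← hWN,
      slash_frickeGL_slash_mapGL f hγ', smul_smul]
  -- both sums live on the units
  have hvan : ∀ (F : ℍ → ℂ) (u : ZMod m), ¬ IsUnit u → χ u • F = 0 := fun F u hu ↦ by
    rw [MulChar.map_nonunit χ hu, zero_smul]
  rw [coe_twistRaw, hχ.inv, finset_sum_slash,
    sum_univ_eq_sum_units (fun u : ZMod m ↦ (χ u • ((⇑f : ℍ → ℂ) ∣[k] twistT u)) ∣[k] WL)
      (fun u hu ↦ by rw [hvan _ u hu, SlashAction.zero_slash]),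
    sum_univ_eq_sum_units (fun w : ZMod m ↦ χ w • (((⇑f : ℍ → ℂ) ∣[k] WN) ∣[k] twistT w))
      (fun u hu ↦ hvan _ u hu)]
  simp_rw [key]
  -- re-index by the involution `u ↦ −(uN)⁻¹`
  have hre : ∑ x : (ZMod m)ˣ, (χ (x : ZMod m) * (m : ℂ) ^ (k - 2)) •
        (((⇑f : ℍ → ℂ) ∣[k] WN) ∣[k] twistT (e x : ZMod m)) =
      ∑ w : (ZMod m)ˣ, (χ (e w : ZMod m) * (m : ℂ) ^ (k - 2)) •
        (((⇑f : ℍ → ℂ) ∣[k] WN) ∣[k] twistT (w : ZMod m)) := by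
    rw [← Equiv.sum_comp (he.toPerm _) (fun w : (ZMod m)ˣ ↦
      (χ (e w : ZMod m) * (m : ℂ) ^ (k - 2)) •
        (((⇑f : ℍ → ℂ) ∣[k] WN) ∣[k] twistT (w : ZMod m)))]
    refine Finset.sum_congr rfl fun u _ ↦ ?_
    simp only [Function.Involutive.coe_toPerm, he u]
  rw [hre, Finset.smul_sum]
  refine Finset.sum_congr rfl fun w _ ↦ ?_
  rw [show χ (e w : ZMod m) = χ (-1) * χ N * χ (w : ZMod m) from apply_frickeTwistPerm hχ hNm w,
    smul_smul]
  congr 1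
  ring

omit [NeZero N] in
/-- The normalisation constants: `(Nm²)^{1−k/2} · m^{k−2} = N^{1−k/2}` (`m ≥ 1`). [folklore] -/
theorem rpow_mul_sq_mul_zpow_eq (k : ℤ) :
    ((((N * m ^ 2 : ℕ) : ℝ) ^ (1 - (k : ℝ) / 2) : ℝ) : ℂ) * (m : ℂ) ^ (k - 2) =
      (((N : ℝ) ^ (1 - (k : ℝ) / 2) : ℝ) : ℂ) := by
  have hm0 : (0 : ℝ) ≤ m := Nat.cast_nonneg m
  have h1 : (((m ^ 2 : ℕ) : ℝ) ^ (1 - (k : ℝ) / 2) : ℝ) = (m : ℝ) ^ ((2 - k : ℤ)) := by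
    rw [Nat.cast_pow, ← Real.rpow_natCast (m : ℝ) 2, ← Real.rpow_mul hm0, ← Real.rpow_intCast]
    congr 1
    push_cast
    ring
  have h2 : ((((N * m ^ 2 : ℕ) : ℝ) ^ (1 - (k : ℝ) / 2) : ℝ) : ℂ) =
      (((N : ℝ) ^ (1 - (k : ℝ) / 2) : ℝ) : ℂ) * ((((m ^ 2 : ℕ) : ℝ) ^ (1 - (k : ℝ) / 2) : ℝ) : ℂ) := by
    rw [← Complex.ofReal_mul, ← Real.mul_rpow (Nat.cast_nonneg N) (Nat.cast_nonneg (m ^ 2))]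
    push_cast
    ring_nf
  rw [h2, h1, mul_assoc]
  push_cast
  rw [← zpow_add₀ (by exact_mod_cast NeZero.ne m : (m : ℂ) ≠ 0)]
  norm_num

/-- **`w_{Nm²} (f_χ) = χ(−1) χ(N) (w_N f)_χ`**: the Fricke involution of level `Nm²` of the twist of
`f ∈ S_k(Γ₀(N))` by a quadratic character `χ` mod `m`, `(m, N) = 1`, is `χ(−N)` times the twist of
`w_N f` (Atkin–Lehner 1970, §6; Shimura 1971, Thm. 3.66; Iwaniec 1997, Thm. 7.5: the root number of
`f ⊗ χ` is `χ(−N)` times that of `f` for real `χ`). [cite: AtkinLehner1970, §6] -/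
theorem frickeInvolution_charTwist (hNm : N.Coprime m) {χ : DirichletCharacter ℂ m}
    (hχ : χ.IsQuadratic) (f : CuspForm (Gamma0 N) k) :
    frickeInvolution (N * m ^ 2) k
        (charTwist (N * m ^ 2) (dvd_mul_right N (m ^ 2)) (dvd_mul_left (m ^ 2) N) hχ f) =
      (χ (-1) * χ N) •
        charTwist (N * m ^ 2) (dvd_mul_right N (m ^ 2)) (dvd_mul_left (m ^ 2) N) hχ
          (frickeInvolution N k f) := by
  apply DFunLike.coe_injective
  rw [frickeInvolution_apply_eq_slash_holds (N * m ^ 2) k, coe_charTwist, ModularForm.smul_slash,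
    σ_glCast, coe_twistRaw_slash_frickeGL hNm f hχ, CuspForm.IsGLPos.coe_smul, coe_charTwist,
    coe_twistRaw, frickeInvolution_apply_eq_slash_holds N k]
  simp_rw [ModularForm.smul_slash, σ_twistT,
    smul_comm (χ⁻¹ _) ((((N : ℝ) ^ (1 - (k : ℝ) / 2) : ℝ) : ℂ)), ← Finset.smul_sum, smul_smul]
  congr 1
  linear_combination (χ (-1) * χ N * (gaussSum χ⁻¹ (ZMod.stdAddChar (N := m)))⁻¹) *
    rpow_mul_sq_mul_zpow_eq (N := N) (m := m) k

/-- The twist is homogeneous in `f`: `(c • f)_χ = c • f_χ`. [folklore] -/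
theorem charTwist_smul (L : ℕ) [NeZero L] (hN : N ∣ L) (hm : m ^ 2 ∣ L) {χ : DirichletCharacter ℂ m}
    (hχ : χ.IsQuadratic) (c : ℂ) (f : CuspForm (Gamma0 N) k) :
    charTwist L hN hm hχ (c • f) = c • charTwist L hN hm hχ f := by
  apply DFunLike.coe_injective
  rw [coe_charTwist, CuspForm.IsGLPos.coe_smul, coe_charTwist, twistRaw_smul, CuspForm.IsGLPos.coe_smul,
    smul_comm]

/-- **`w_{Nm²} f_χ = χ(−N) ε f_χ` when `w_N f = ε f`** (Atkin–Lehner 1970, §6; Iwaniec 1997,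
Thm. 7.5): the twist of a `w_N`-eigenform by a quadratic character mod `m`, `(m, N) = 1`, is a
`w_{Nm²}`-eigenform with eigenvalue `χ(−1) χ(N) ε`. [cite: AtkinLehner1970, §6] -/
theorem frickeInvolution_charTwist_of_eq_smul (hNm : N.Coprime m) {χ : DirichletCharacter ℂ m}
    (hχ : χ.IsQuadratic) {f : CuspForm (Gamma0 N) k} {ε : ℂ} (hf : frickeInvolution N k f = ε • f) :
    frickeInvolution (N * m ^ 2) k
        (charTwist (N * m ^ 2) (dvd_mul_right N (m ^ 2)) (dvd_mul_left (m ^ 2) N) hχ f) =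
      (χ (-1) * χ N * ε) •
        charTwist (N * m ^ 2) (dvd_mul_right N (m ^ 2)) (dvd_mul_left (m ^ 2) N) hχ f := by
  rw [frickeInvolution_charTwist hNm hχ f, hf, charTwist_smul, smul_smul]

end Slash

/-! ### The same statements at a level `L = Nm²` given propositionally -/

section Level

variable {N : ℕ} [NeZero N] {k : ℤ} {m : ℕ} [NeZero m] {L : ℕ} [NeZero L]

/-- `w_L (f_χ) = χ(−1) χ(N) (w_N f)_χ` at a level `L = Nm²` (`frickeInvolution_charTwist` transported
along `hL`). [cite: AtkinLehner1970, §6] -/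
theorem frickeInvolution_charTwist_of_eq (hL : L = N * m ^ 2) (hNm : N.Coprime m) (hNL : N ∣ L)
    (hmL : m ^ 2 ∣ L) {χ : DirichletCharacter ℂ m} (hχ : χ.IsQuadratic) (f : CuspForm (Gamma0 N) k) :
    frickeInvolution L k (charTwist L hNL hmL hχ f) =
      (χ (-1) * χ N) • charTwist L hNL hmL hχ (frickeInvolution N k f) := by
  subst hL
  exact frickeInvolution_charTwist hNm hχ f

/-- `w_L f_χ = χ(−1) χ(N) ε f_χ` at a level `L = Nm²`, when `w_N f = ε f`. [cite: AtkinLehner1970, §6] -/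
theorem frickeInvolution_charTwist_of_eq_of_eq_smul (hL : L = N * m ^ 2) (hNm : N.Coprime m)
    (hNL : N ∣ L) (hmL : m ^ 2 ∣ L) {χ : DirichletCharacter ℂ m} (hχ : χ.IsQuadratic)
    {f : CuspForm (Gamma0 N) k} {ε : ℂ} (hf : frickeInvolution N k f = ε • f) :
    frickeInvolution L k (charTwist L hNL hmL hχ f) = (χ (-1) * χ N * ε) • charTwist L hNL hmL hχ f := by
  subst hL
  exact frickeInvolution_charTwist_of_eq_smul hNm hχ hf

end Level

end Literature.NumberTheory.EllipticCurves.ModularForms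

end
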